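import Summits.QuantumFields.YangMills.Theorems.UnitScaleTiltHalvingHSiteBaseDataOfSockets
import Summits.QuantumFields.YangMills.Theorems.UnitScaleTiltHalvingP1FlatCoreSupplierDatumTrace
import HarnessLib

/-!
# `hP1room` PROGRAMME (LEAD-H «H = hSupUρ3 ⟸ hMember», 2026-08-28T19:11Z «FULL k ≥ 2 → ★w3-19200»), FILE A₂ of the `2 ≤ K − n` per-site composer:
# ★★ THE MEMBER's DATUM — J3's `SU(2)` pre-gauge, THEOREM 4's datum `(u₁, W, A)` at level `K − n − 1` read from ONE ∀-closed socket, its trace row,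
# and F3's tower at the composite gauge `(u₁ ∘ rep)⁻¹·ĝJ`; ★ and that socket FROM the four raw Proposition-5∕(1.42)∕(1.59) sockets by (τ-D)

Route `UnitScaleTilt`, crux K1 child «MinimiserStabilityRegPr» (stmt-QuantumFields-19200), registered stub `stub_halvingStep` (`BirthV10`), displayed text
«H = hMember» (✓p657837 `HalvingHSupURho3OfMemberRows.hSupUρ3_of_memberRows`).  Cell `ym3-torus` (HUMAN RULING D-0037: YM₃ on T³ is ladder rung R3 — NOT d = 4,
NOT a mass gap, NOT the Clay problem), width seat `ym-ust-19200-w3` gen 8 (H-door lineage).  `--supports stmt-QuantumFields-19200 --as helper`; THEOREMS ONLY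
(0 `def`, 0 `sorry`); count-neutral; nothing here claims `hMember`, `hSupUρ3`, the stub, the crux or the gap.

WHAT (★w3-20520 g6's call-graph memo `KSITE-FULL-CALLGRAPH-w3g6.md` §1–§3, the `k ≥ 2` twin of ★w7-19200 g5's ✓p659785 `baseData_of_sockets`).
`k := K − n ≥ 2`, `η := L^{−k}`, corner `a := Bᵏx₀ − t`, window `(M′, ρ′ := ρ+M+L+S)`, `U′ := pull (U^{gJ})♯ 0`, `s := (198 + 12(M′−1+4ρ′))ε₀` (J3's near-`1` radius = ★t4-w13's `a₆₆`).
* §1 ★★ `siteDatum_of_T4` — from `hMember`'s antecedents at one site and ONE displayed socket `hT4` («Theorem 4's datum at every level `m ≤ k` for the pre-gauged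
  field», ∀-CLOSED over the member's `SU(2)` gauge `gJ` with J3's two guards (1.34)-𝔄 and the fine near-`1` `< s` on □̃ as antecedents — LEAD-H LETTER RULE
  2026-08-28T18:39Z; it is the CONCLUSION of (τ-D) ✓p654692 `HalvingP1FlatCoreSupplierInductionSU.datum_of_preGauge_cubeMember_SU`, see §2): `∃ gJ u₁ W A κf` with
  J3's rows (✓`exists_preGauge_chart_su`: (1.34)-𝔄, axial at every family, (1.66) on the whole tower below □̃), Theorem 4's datum rows AT LEVEL `k − 1` (`u₁`
  special unitary, (1.29), `W^{u₁} = U′`, Landau (1.38), the chart-with-size rows (1.36) on the touched sides at size `c⋆`), the trace row `tr A = 0` there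
  (✓p657841 `hAτ_of_datum_pull`, window `c⋆ ≤ 1∕16`), and F3's two tower rows (✓`exists_effGaugeFun` at the composite gauge).
* §2 ★ `hT4_of_rawSockets` — INHABITABILITY OF THE SOCKET (OWNER №9 (3)): `hT4` ⟸ the four raw sockets `hP5base hP5 H42 H59` of ✓p654692, ∀-closed over `gJ` in the
  same way, + (N05-WINDOWS)' Theorem-4 windows at `(α₀, a) := (ε₀, s)` (★t4-w13 ✓`exists_topCall_constants_of_rhoWindow₃` (2)) — one `exact` of ✓p654692 per gauge
  (lit ✓`hbox_cubeLamB` for the bond boxes).  So (K-final) may display either `hT4` or the four raw sockets.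
HONEST SCOPE.  By-name composition + the □̃ no-wrap∕`l1` arithmetic copied from ✓p659785; nothing of Prop. 5, Theorem 4, [4] or the stub is proved here.

References: T. Bałaban, CMP **99** (1985) 75–102 [Balaban1985RegularSpaces] (Thm 4 p.88, Prop. 5 (1.106)–(1.109) p.94, (1.29) p.81, (1.36) p.82, (1.66) p.87, p.98);
CMP **99** (1985) 389–434 [Balaban1985BackgroundPropagators] (Thm 3.3 p.398); CMP **102** (1985) 277–309 [Balaban1985Variational] ((152) p.301); CMP **98** (1985) 17–51
[Balaban1985Averaging] ((8) p.18, (19)–(23) pp.20–21).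
-/

set_option autoImplicit false

noncomputable section

open scoped BigOperators Matrix.Norms.L2Operator
open NormedSpace
open Complex (I)

namespace Summit.QuantumFields.YangMills.Theorems.HalvingHSiteDatumOfSockets

open Literature.MathematicalPhysics.QuantumFieldTheory.Balaban1983to89
open Literature.MathematicalPhysics.QuantumFieldTheory.Balaban1983to89.T3ContinuumYM3Torus
open Literature.MathematicalPhysics.QuantumFieldTheory.Balaban1983to89.T3PrintedRegularMinimiser (RegPr regFibrePr mem_regFibrePr_iff)
open MatrixLog (mlog)
open B5Eq118OneStroke (iterBlockOf)
open B7Prop1Explicit (e expUnit l1)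
open B7Prop1Explicit renaming Site → LSite
open B7Prop2Explicit (unitaryUnits C0 c2' avgIter)
open B7Prop3Flat (c3)
open B7Prop1Local (InBox loK bondHiK)
open B7Eq92Concrete (mgauge)
open B8Ineq130 (tlo thi)
open B8Ineq132 (covDerivFwd InAk)
open B8Eq119TwistedAxial (Restr129 InAx)
open B8Eq131Cubes (cube gs tLo tHi)
open B8Eq131CubesAdmissible (cubeFam)
open B8CubeMemberZd (cubeLamS cubeLamB hbox_cubeLamB)
open B8Eq184Proof (gaugeExp cfgExp)
open B8Eq140Level (SideTouches)
open B8Eq146AExpansion (iEta)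
open B8Eq138LandauZd (IsLandau138W)
open B7Prop4GeneralLevels (logCovIter linCovIter)
open B8Eq155JBound (Jcur wsup)
open B8ScaledSupNorm (bondNorm msup)
open B8SpecialUnitaryTrace (trCLM)
open B7Prop2SpecialUnitary (specialUnitaryUnits)
open B10Eq27TorusAxialLog (transl rel pull pull_apply unitsField toUField suIncl gaugeActT unitsField_mem_unitaryUnits)
open B15Eq112TorusCover (lift)
open Summit.QuantumFields.YangMills.Theorems.Prop8ChartDoubleBar (dbarIterU vframeU)
open Summit.QuantumFields.YangMills.Theorems (FlatMinimizerH.le_T3)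
open HalvingP1FlatCoreSupplierPreGaugeMember (exists_preGauge_chart_su)
open P1FlatCoreCubeInclusion (corner_of_offset room_of_level_k)
open P1FlatCoreFrameLinLipschitz (exists_effGaugeFun)
open HalvingP1FlatCoreSupplierInductionSU (datum_of_preGauge_cubeMember_SU)
open HalvingP1FlatCoreSupplierDatumTrace (hAτ_of_datum_pull)

variable (F : T3Family) {n K : ℕ}

/-! ## §0 The member's window arithmetic (verbatim from ✓p659785; k-generic) -/

/-- The □̃ no-wrap, the room in level-`k` units and J3's `l1` letter at the member `a := Bᵏx₀ − t`, `ρ′ := ρ+M+L+S` (bookkeeping copied from ✓p659785).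
[cite: Balaban1985RegularSpaces, p.98; Balaban1985Variational, (152) p.301] -/
theorem member_windows (L : ℕ) (hF : F.L = L) (hnK : n < K) (ρ S M M' : ℕ) {ε₀ : ℝ}
    (hroom : 2 * ρ + (M' + 1 + 2 * (M + L + S)) ≤ F.L ^ (F.m + n)) (x₀ : Site (F.P K) 0) {t : ℤ} (ht0 : 0 ≤ t) (ht : t ≤ (M' : ℤ) - 1) :
    (2 * ((F.P K).L ^ (K - n) * (M' + 1) + (ρ + M + L + S) * gs (F.P K).L (K - n)) ≤ (F.P K).sitesPerDir 0) ∧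
    (∀ i, tHi (fun μ => ((iterBlockOf (K - n) x₀ μ).val : ℤ) - t) M' (ρ + M + L + S) i -
        tLo (fun μ => ((iterBlockOf (K - n) x₀ μ).val : ℤ) - t) (ρ + M + L + S) i < ((F.P K).sitesPerDir (K - n) : ℤ)) ∧
    (11 * ((F.P K).d : ℝ) ^ 2 * (2 * ε₀) +
      l1 (tHi (fun μ => ((iterBlockOf (K - n) x₀ μ).val : ℤ) - t) M' (ρ + M + L + S) -
        tLo (fun μ => ((iterBlockOf (K - n) x₀ μ).val : ℤ) - t) (ρ + M + L + S)) * (2 * (2 * ε₀)) =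
      (198 + 12 * (((M' : ℝ) - 1) + 4 * ((ρ + M + L + S : ℕ) : ℝ))) * ε₀) := by
  have hd3 : (F.P K).d = 3 := T3Family.P_d F K
  have hkP : K - n ≤ (F.P K).m + (F.P K).K := FlatMinimizerH.le_T3 F n K
  have hsites : (F.P K).sitesPerDir (K - n) = 2 * F.L ^ (F.m + n) := by
    show 2 * F.L ^ (F.m + K - (K - n)) = _
    congr 2; omega
  refine ⟨?_, ?_, ?_⟩
  · refine room_of_level_k (P := F.P K) hkP ?_
    rw [hsites, ← hF]; omega
  · intro i
    simp only [tHi, tLo, hsites]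
    have h : (M' : ℤ) - 1 + 4 * (ρ + M + L + S) < 2 * (F.L : ℤ) ^ (F.m + n) := by
      have h2 : ((2 * ρ + (M' + 1 + 2 * (M + L + S)) : ℕ) : ℤ) ≤ ((F.L ^ (F.m + n) : ℕ) : ℤ) := by exact_mod_cast hroom
      push_cast at h2
      linarith
    push_cast; linarith
  · unfold l1
    have hterm : ∀ κ : Fin (F.P K).d,
        (((tHi (fun μ => ((iterBlockOf (K - n) x₀ μ).val : ℤ) - t) M' (ρ + M + L + S) -
            tLo (fun μ => ((iterBlockOf (K - n) x₀ μ).val : ℤ) - t) (ρ + M + L + S)) κ).natAbs : ℝ) =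
          ((M' : ℝ) - 1) + 4 * ((ρ + M + L + S : ℕ) : ℝ) := by
      intro κ
      have hv : (tHi (fun μ => ((iterBlockOf (K - n) x₀ μ).val : ℤ) - t) M' (ρ + M + L + S) -
          tLo (fun μ => ((iterBlockOf (K - n) x₀ μ).val : ℤ) - t) (ρ + M + L + S)) κ = (M' : ℤ) - 1 + 4 * (ρ + M + L + S) := by
        simp only [Pi.sub_apply, tHi, tLo]; push_cast; ring
      have hnn : (0 : ℤ) ≤ (M' : ℤ) - 1 + 4 * (ρ + M + L + S) := by
        have h4 : (0 : ℤ) ≤ (ρ + M + L + S : ℕ) := by positivity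
        push_cast at h4 ⊢; linarith
      have hnnR : (0 : ℝ) ≤ (((M' : ℤ) - 1 + 4 * (ρ + M + L + S) : ℤ) : ℝ) := by exact_mod_cast hnn
      rw [hv, Nat.cast_natAbs, Int.cast_abs, abs_of_nonneg hnnR]
      push_cast; ring
    rw [Nat.cast_sum, Finset.sum_congr rfl fun κ _ => hterm κ, Finset.sum_const, Finset.card_univ, Fintype.card_fin, hd3, nsmul_eq_mul]
    push_cast; ring

/-! ## §1 The member's datum from the Theorem-4 socket -/

set_option maxHeartbeats 400000 in
/-- ★★ **THE MEMBER's DATUM (FILE A₂ of the `2 ≤ K − n` composer)** — see the module docstring: J3's `SU(2)` pre-gauge rows, Theorem 4's datum at level `K − n − 1`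
from the ∀-closed socket `hT4`, the datum's trace row, F3's tower at the composite gauge. [cite: Balaban1985RegularSpaces, Thm 4 p.88, (1.29) p.81, (1.36) p.82, (1.66) p.87, p.98; Balaban1985Variational, (152) p.301; Balaban1985Averaging, (8) p.18, (20)-(23) pp.20-21] -/
theorem siteDatum_of_T4 (L : ℕ) (hF : F.L = L) (hnK : n < K) (h2 : 2 ≤ K - n)
    -- `hMember`'s antecedents read at one site: the member, the pre-gauge's smallnesses, the room, the field, the site; the window letter `t` and the corner `a`
    (ρ S M M' : ℕ) {ρ' : ℕ} (hρ'def : ρ' = ρ + M + L + S) {ε₀ : ℝ} (hε₀ : 0 < ε₀) (hε : 10 ^ 7 * (F.L : ℝ) ^ 3 * ε₀ ≤ 1)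
    {s : ℝ} (hsdef : s = (198 + 12 * (((M' : ℝ) - 1) + 4 * ρ')) * ε₀) (hs6 : s ≤ 1 / 6)
    (hroom : 2 * ρ + (M' + 1 + 2 * (M + L + S)) ≤ F.L ^ (F.m + n))
    (V : GaugeField (F.P n) 0 (Matrix.specialUnitaryGroup (Fin 2) ℂ)) (U : GaugeField (F.P K) 0 (Matrix.specialUnitaryGroup (Fin 2) ℂ))
    (hU : U ∈ regFibrePr F n K hnK.le ε₀ V) (x₀ : Site (F.P K) 0)
    {t : ℤ} (ht0 : 0 ≤ t) (ht : t ≤ (M' : ℤ) - 1) {a : LSite (F.P K).d} (hadef : a = fun μ => ((iterBlockOf (K - n) x₀ μ).val : ℤ) - t)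
    -- Theorem 4's size constant `c⋆` (★t4-w13's letter `cstar`) and the one window the trace row needs
    {cstar : ℝ} (hcs16 : cstar ≤ 1 / 16)
    -- SOCKET `hT4`: Theorem 4's datum at every level `m ≤ K − n` for the pre-gauged field `U′ := pull (U^{gJ})♯ 0`, ∀-closed over the member's `SU(2)` gauge,
    -- J3's (1.34)-𝔄 and the fine near-`1` `< s` on □̃ as antecedents (the CONCLUSION of (τ-D) ✓p654692 at this member; §2)
    (hT4 : ∀ gJ : GaugeTransf (F.P K) 0 (Matrix.specialUnitaryGroup (Fin 2) ℂ),
      InAk (F.P K).L (K - n) (((F.L : ℝ)⁻¹) ^ (K - n)) ε₀ (fun _ => (Set.univ : Set (LSite (F.P K).d))) (pull (unitsField (toUField (GaugeField.gaugeAct gJ U))) 0) →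
      (∀ (x : LSite (F.P K).d) (ν : Fin (F.P K).d), tlo (F.P K).L (tLo a ρ') (K - n) ≤ x → x + e ν ≤ thi (F.P K).L (tHi a M' ρ') (K - n) →
        ‖((pull (unitsField (toUField (GaugeField.gaugeAct gJ U))) 0 x ν : (Matrix (Fin 2) (Fin 2) ℂ)ˣ) : Matrix (Fin 2) (Fin 2) ℂ) - 1‖ < s) →
      ∀ m, m ≤ K - n → ∃ u : LSite (F.P K).d → (Matrix (Fin 2) (Fin 2) ℂ)ˣ,
        (∀ x, ((u x : (Matrix (Fin 2) (Fin 2) ℂ)ˣ) : Matrix (Fin 2) (Fin 2) ℂ) ∈ Matrix.specialUnitaryGroup (Fin 2) ℂ) ∧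
        Restr129 (F.P K).L m (cubeLamS (F.P K).L a M' ρ' (K - n) m) (1 : LSite (F.P K).d → Fin (F.P K).d → (Matrix (Fin 2) (Fin 2) ℂ)ˣ) u ∧
        ∃ W : LSite (F.P K).d → Fin (F.P K).d → (Matrix (Fin 2) (Fin 2) ℂ)ˣ,
          mgauge (1 : LSite (F.P K).d → Fin (F.P K).d → (Matrix (Fin 2) (Fin 2) ℂ)ˣ) u W = pull (unitsField (toUField (GaugeField.gaugeAct gJ U))) 0 ∧
          (1 ≤ m → IsLandau138W (F.P K).L m (((F.L : ℝ)⁻¹) ^ (K - n)) (cubeFam false (F.P K).L a M' ρ' (K - n) 0) (cubeLamS (F.P K).L a M' ρ' (K - n) m)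
            (1 : LSite (F.P K).d → Fin (F.P K).d → (Matrix (Fin 2) (Fin 2) ℂ)ˣ) W) ∧
          ∃ A : LSite (F.P K).d → Fin (F.P K).d → Matrix (Fin 2) (Fin 2) ℂ, ∀ j, j ≤ m →
            ∀ b ∈ {b : LSite (F.P K).d × Fin (F.P K).d | SideTouches (cubeFam false (F.P K).L a M' ρ' (K - n) j) b.1 b.2},
              W b.1 b.2 = cfgExp (((F.L : ℝ)⁻¹) ^ (K - n)) A b.1 b.2 ∧ IsSelfAdjoint (A b.1 b.2) ∧
                ‖A b.1 b.2‖ ≤ cstar * (((F.P K).L : ℝ) ^ j * ((F.L : ℝ)⁻¹) ^ (K - n))⁻¹) :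
    ∃ (gJ : GaugeTransf (F.P K) 0 (Matrix.specialUnitaryGroup (Fin 2) ℂ)) (u₁ : LSite (F.P K).d → (Matrix (Fin 2) (Fin 2) ℂ)ˣ)
      (W : LSite (F.P K).d → Fin (F.P K).d → (Matrix (Fin 2) (Fin 2) ℂ)ˣ) (A : LSite (F.P K).d → Fin (F.P K).d → Matrix (Fin 2) (Fin 2) ℂ)
      (κf : (Site (F.P K) 0 → Matrix (Fin 2) (Fin 2) ℂ) → (i : ℕ) → GaugeTransf (F.P K) i (Matrix (Fin 2) (Fin 2) ℂ)ˣ),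
      -- J3's rows for `U′`: (1.34)-𝔄 on `ℤᵈ`, axial at the flat background for every family, (1.66) on the whole tower below □̃
      InAk (F.P K).L (K - n) (((F.L : ℝ)⁻¹) ^ (K - n)) ε₀ (fun _ => (Set.univ : Set (LSite (F.P K).d))) (pull (unitsField (toUField (GaugeField.gaugeAct gJ U))) 0) ∧
      (∀ m', m' ≤ K - n → ∀ Λ : ℕ → Set (LSite (F.P K).d),
        InAx (F.P K).L m' Λ (1 : LSite (F.P K).d → Fin (F.P K).d → (Matrix (Fin 2) (Fin 2) ℂ)ˣ) (pull (unitsField (toUField (GaugeField.gaugeAct gJ U))) 0)) ∧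
      (∀ m', m' ≤ K - n → ∀ (x : LSite (F.P K).d) (ν : Fin (F.P K).d), tlo (F.P K).L (tLo a ρ') m' ≤ x → x + e ν ≤ thi (F.P K).L (tHi a M' ρ') m' →
        ‖((avgIter (F.P K).L (pull (unitsField (toUField (GaugeField.gaugeAct gJ U))) 0) (K - n - m') x ν : (Matrix (Fin 2) (Fin 2) ℂ)ˣ) :
            Matrix (Fin 2) (Fin 2) ℂ) - 1‖ < s) ∧
      -- Theorem 4's datum rows at level `K − n − 1`: `u₁` special unitary, (1.29), `W^{u₁} = U′`, Landau (1.38), chart-with-size (1.36) on the touched sides, trace row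
      (∀ z, ((u₁ z : (Matrix (Fin 2) (Fin 2) ℂ)ˣ) : Matrix (Fin 2) (Fin 2) ℂ) ∈ Matrix.specialUnitaryGroup (Fin 2) ℂ) ∧
      Restr129 (F.P K).L (K - n - 1) (cubeLamS (F.P K).L a M' ρ' (K - n) (K - n - 1)) (1 : LSite (F.P K).d → Fin (F.P K).d → (Matrix (Fin 2) (Fin 2) ℂ)ˣ) u₁ ∧
      mgauge (1 : LSite (F.P K).d → Fin (F.P K).d → (Matrix (Fin 2) (Fin 2) ℂ)ˣ) u₁ W = pull (unitsField (toUField (GaugeField.gaugeAct gJ U))) 0 ∧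
      IsLandau138W (F.P K).L (K - n - 1) (((F.L : ℝ)⁻¹) ^ (K - n)) (cubeFam false (F.P K).L a M' ρ' (K - n) 0) (cubeLamS (F.P K).L a M' ρ' (K - n) (K - n - 1))
        (1 : LSite (F.P K).d → Fin (F.P K).d → (Matrix (Fin 2) (Fin 2) ℂ)ˣ) W ∧
      (∀ j, j ≤ K - n - 1 → ∀ b ∈ {b : LSite (F.P K).d × Fin (F.P K).d | SideTouches (cubeFam false (F.P K).L a M' ρ' (K - n) j) b.1 b.2},
        W b.1 b.2 = cfgExp (((F.L : ℝ)⁻¹) ^ (K - n)) A b.1 b.2 ∧ IsSelfAdjoint (A b.1 b.2) ∧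
          ‖A b.1 b.2‖ ≤ cstar * (((F.P K).L : ℝ) ^ j * ((F.L : ℝ)⁻¹) ^ (K - n))⁻¹) ∧
      (∀ j, j ≤ K - n - 1 → ∀ b ∈ {b : LSite (F.P K).d × Fin (F.P K).d | SideTouches (cubeFam false (F.P K).L a M' ρ' (K - n) j) b.1 b.2},
        trCLM (Fin 2) (A b.1 b.2) = 0) ∧
      -- F3's tower of the charted iterate at the composite gauge `(u₁ ∘ rep)⁻¹·ĝJ`
      (∀ (m : Site (F.P K) 0 → Matrix (Fin 2) (Fin 2) ℂ) (i : ℕ) (y : Site (F.P K) (i + 1)),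
        κf m (i + 1) y = (vframeU (gaugeActT (κf m i) (dbarIterU i (gaugeActT
          (fun s => (u₁ (lift (F.P K) x₀ + rel x₀ s))⁻¹ * Unitary.toUnits (suIncl (gJ s)) : GaugeTransf (F.P K) 0 (Matrix (Fin 2) (Fin 2) ℂ)ˣ)
          (unitsField (toUField U))))) y)⁻¹ * κf m i (emb y) *
          vframeU (dbarIterU i (gaugeActT
            (fun s => (u₁ (lift (F.P K) x₀ + rel x₀ s))⁻¹ * Unitary.toUnits (suIncl (gJ s)) : GaugeTransf (F.P K) 0 (Matrix (Fin 2) (Fin 2) ℂ)ˣ)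
            (unitsField (toUField U)))) y) ∧
      (∀ (m : Site (F.P K) 0 → Matrix (Fin 2) (Fin 2) ℂ) (x : Site (F.P K) 0), ((κf m 0 x : (Matrix (Fin 2) (Fin 2) ℂ)ˣ) : Matrix (Fin 2) (Fin 2) ℂ) = exp (m x)) := by
  classical
  subst hadef hρ'def
  have hL2 : 2 ≤ (F.P K).L := (F.P K).hL.2
  have hL1 : 1 ≤ (F.P K).L := le_trans (by norm_num) hL2
  have hη : 0 < ((F.L : ℝ)⁻¹) ^ (K - n) := by
    have hL0 : (0 : ℝ) < F.L := by exact_mod_cast (F.P K).L_pos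
    positivity
  have hUreg : RegPr F n K ε₀ U := ((mem_regFibrePr_iff F).1 hU).2
  obtain ⟨-, hwrap, hsJ⟩ := member_windows F L hF hnK ρ S M M' (ε₀ := ε₀) hroom x₀ ht0 ht
  have hsmallJ : 11 * ((F.P K).d : ℝ) ^ 2 * (2 * ε₀) +
      l1 (tHi (fun μ => ((iterBlockOf (K - n) x₀ μ).val : ℤ) - t) M' (ρ + M + L + S) -
        tLo (fun μ => ((iterBlockOf (K - n) x₀ μ).val : ℤ) - t) (ρ + M + L + S)) * (2 * (2 * ε₀)) ≤ 1 / 6 := by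
    rw [hsJ, ← hsdef]; exact hs6
  -- J3 at the member with the SU(2) gauge explicit (✓`exists_preGauge_chart_su`)
  obtain ⟨gJ, A₀, -, hInAk, hInAx, htower, -, -, -, hterr⟩ :=
    exists_preGauge_chart_su F hnK hε₀ hε hUreg (fun μ => ((iterBlockOf (K - n) x₀ μ).val : ℤ) - t) M' (ρ + M + L + S) hwrap hsmallJ
  rw [hsJ, ← hsdef] at hterr htower
  have hfine : ∀ (x : LSite (F.P K).d) (ν : Fin (F.P K).d),
      tlo (F.P K).L (tLo (fun μ => ((iterBlockOf (K - n) x₀ μ).val : ℤ) - t) (ρ + M + L + S)) (K - n) ≤ x →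
      x + e ν ≤ thi (F.P K).L (tHi (fun μ => ((iterBlockOf (K - n) x₀ μ).val : ℤ) - t) M' (ρ + M + L + S)) (K - n) →
      ‖((pull (unitsField (toUField (GaugeField.gaugeAct gJ U))) 0 x ν : (Matrix (Fin 2) (Fin 2) ℂ)ˣ) : Matrix (Fin 2) (Fin 2) ℂ) - 1‖ < s :=
    fun x ν h1 h2 => (hterr x ν h1 h2).2.2
  -- Theorem 4's datum at level `K − n − 1` (the socket)
  obtain ⟨u₁, hu₁SU, h129, W, hW, hLan, A, hdat⟩ := hT4 gJ hInAk hfine (K - n - 1) (Nat.sub_le _ _)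
  have hLan' := hLan (by omega)
  -- the trace row (✓p657841)
  have hAτ := hAτ_of_datum_pull (GaugeField.gaugeAct gJ U) 0 hη hL1
    (cubeFam false (F.P K).L (fun μ => ((iterBlockOf (K - n) x₀ μ).val : ℤ) - t) M' (ρ + M + L + S) (K - n)) hu₁SU hW hcs16 hdat
  -- F3's effective-gauge tower at the composite gauge
  obtain ⟨κf, hκfs, hκf0, -⟩ := exists_effGaugeFun (P := F.P K) (gaugeActT
    (fun s => (u₁ (lift (F.P K) x₀ + rel x₀ s))⁻¹ * Unitary.toUnits (suIncl (gJ s)) : GaugeTransf (F.P K) 0 (Matrix (Fin 2) (Fin 2) ℂ)ˣ)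
    (unitsField (toUField U)))
  exact ⟨gJ, u₁, W, A, κf, hInAk, hInAx, htower, hu₁SU, h129, hW, hLan', hdat, hAτ, hκfs, hκf0⟩

/-! ## §2 The socket `hT4` from the four raw Proposition-5 ∕ (1.42) ∕ (1.59) sockets (inhabitability, OWNER №9 (3)) -/

set_option maxHeartbeats 400000 in
/-- ★ **THE THEOREM-4 SOCKET FROM THE FOUR RAW SOCKETS** — `hT4` of `siteDatum_of_T4` ⟸ ✓p654692 `datum_of_preGauge_cubeMember_SU`'s `hP5base hP5 H42 H59`, each
∀-closed over the member's `SU(2)` gauge `gJ` (`U′ := pull (U^{gJ})♯ 0`), under (N05-WINDOWS)' Theorem-4 windows at `(α₀, a) := (ε₀, s)`; one `exact` per gauge, the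
bond boxes by lit ✓`hbox_cubeLamB`. [cite: Balaban1985RegularSpaces, Thm 4 p.88, Prop. 5 (1.106)-(1.109) p.94, (1.42) p.83, (1.59) p.86, p.98; Balaban1985BackgroundPropagators, Thm 3.3 p.398] -/
theorem hT4_of_rawSockets (L : ℕ) (hF : F.L = L) (ρ S M M' : ℕ) {ρ' : ℕ} (hρ'def : ρ' = ρ + M + L + S)
    {ε₀ : ℝ} (hε₀ : 0 < ε₀) {s : ℝ} (U : GaugeField (F.P K) 0 (Matrix.specialUnitaryGroup (Fin 2) ℂ)) (x₀ : Site (F.P K) 0)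
    {t : ℤ} {a : LSite (F.P K).d} (hadef : a = fun μ => ((iterBlockOf (K - n) x₀ μ).val : ℤ) - t)
    -- Theorem 4's constants and windows ((τ-D)'s binders VERBATIM at `d := (F.P K).d`, `L := (F.P K).L`, `α₀ := ε₀`, `a := s`)
    {α₁ α₄ B₀ cstar C₂ : ℝ} (hα₁ : 0 ≤ α₁) (hα₄ : 0 ≤ α₄) (hB₀ : 0 ≤ B₀)
    (hc : cstar = 5 * (F.P K).d * (F.P K).L * B₀ * (ε₀ + α₁))
    (hs₁ : α₄ ≤ 1 / 84) (hs₂ : (F.P K).L * cstar ≤ 1 / 12) (hsa4 : s ≤ 1 / 4) (hs2c : 2 * s ≤ cstar)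
    (hα3 : C0 (F.P K).d * ε₀ ≤ 1 / 3) (hα4 : 4 * ε₀ ≤ c2' (F.P K).d (F.P K).L)
    (h16 : 16 * (2 * ((F.P K).L * cstar) + 8 * α₄) ≤ 1) (hd5 : 5 * (2 * ((F.P K).L * cstar) + 8 * α₄) * (((F.P K).d : ℝ) - 1) ≤ 4)
    (hsmall : Real.exp (4 * (800 * (((F.P K).d : ℝ) + 1) ^ 2 * (((F.P K).d : ℝ) + 4)) * ε₀)
      * (1 + 8 * (131072 * (((F.P K).d : ℝ) + 1) ^ 2) * (2 * ((F.P K).L * cstar) + 8 * α₄)) ≤ 2)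
    (hc₃ : 2 * (2 * ((F.P K).L * cstar) + 8 * α₄) ≤ c3 (F.P K).d (F.P K).L) (hside : 36 * (F.P K).d * B₀ * (2 * ((F.P K).L * cstar) + 8 * α₄) ≤ 1 / 2)
    (h50 : 50 * (F.P K).d * (2 * ((F.P K).L * cstar) + 8 * α₄) ≤ 1)
    (hC₂ : 8 * (131072 * (((F.P K).d : ℝ) + 1) ^ 2) * Real.exp (4 * (800 * (((F.P K).d : ℝ) + 1) ^ 2 * (((F.P K).d : ℝ) + 4)) * ε₀) ≤ C₂)
    (h61 : 2 * (2 * ((F.P K).L * cstar) + 8 * α₄) ^ 2 + 20 * (F.P K).d * ε₀ * (2 * ((F.P K).L * cstar) + 8 * α₄)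
      + 2 * C₂ * (2 * ((F.P K).L * cstar) + 8 * α₄) ^ 2 ≤ ε₀ + α₁)
    -- THE FOUR RAW SOCKETS (N05∕N06), ∀-closed over the member's `SU(2)` gauge
    (hP5base : ∀ gJ : GaugeTransf (F.P K) 0 (Matrix.specialUnitaryGroup (Fin 2) ℂ),
      ∃ (v : LSite (F.P K).d → (Matrix (Fin 2) (Fin 2) ℂ)ˣ) (lam : LSite (F.P K).d → (Matrix (Fin 2) (Fin 2) ℂ)), (∀ x, v x ∈ specialUnitaryUnits (Fin 2)) ∧
        (∀ j, j ≤ 1 → ∀ b ∈ {b : LSite (F.P K).d × Fin (F.P K).d | SideTouches ((cubeFam false (F.P K).L a M' ρ' (K - n)) j) b.1 b.2}, (v b.1 : (Matrix (Fin 2) (Fin 2) ℂ)) = ((gaugeExp lam b.1 : (Matrix (Fin 2) (Fin 2) ℂ)ˣ) : (Matrix (Fin 2) (Fin 2) ℂ)) ∧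
          (v (b.1 + e b.2) : (Matrix (Fin 2) (Fin 2) ℂ)) = ((gaugeExp lam (b.1 + e b.2) : (Matrix (Fin 2) (Fin 2) ℂ)ˣ) : (Matrix (Fin 2) (Fin 2) ℂ))) ∧
        (∀ j, j ≤ 1 → ∀ b ∈ {b : LSite (F.P K).d × Fin (F.P K).d | SideTouches ((cubeFam false (F.P K).L a M' ρ' (K - n)) j) b.1 b.2},
          ‖lam b.1‖ ≤ α₄ ∧ (((F.P K).L : ℝ) ^ j * (((F.L : ℝ)⁻¹) ^ (K - n))) * ‖covDerivFwd (((F.L : ℝ)⁻¹) ^ (K - n)) (1 : LSite (F.P K).d → Fin (F.P K).d → (Matrix (Fin 2) (Fin 2) ℂ)ˣ) b.2 lam b.1‖ ≤ α₄) ∧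
        IsLandau138W (F.P K).L 1 (((F.L : ℝ)⁻¹) ^ (K - n)) ((cubeFam false (F.P K).L a M' ρ' (K - n)) 0) ((cubeLamS (F.P K).L a M' ρ' (K - n)) 1) (1 : LSite (F.P K).d → Fin (F.P K).d → (Matrix (Fin 2) (Fin 2) ℂ)ˣ) (mgauge (1 : LSite (F.P K).d → Fin (F.P K).d → (Matrix (Fin 2) (Fin 2) ℂ)ˣ) v⁻¹ (pull (unitsField (toUField (GaugeField.gaugeAct gJ U))) 0)) ∧ Restr129 (F.P K).L 1 ((cubeLamS (F.P K).L a M' ρ' (K - n)) 1) (1 : LSite (F.P K).d → Fin (F.P K).d → (Matrix (Fin 2) (Fin 2) ℂ)ˣ) ((1 : LSite (F.P K).d → (Matrix (Fin 2) (Fin 2) ℂ)ˣ) * v))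
    (hP5 : ∀ gJ : GaugeTransf (F.P K) 0 (Matrix.specialUnitaryGroup (Fin 2) ℂ),
      ∀ m, 1 ≤ m → m < K - n → ∀ (u₁ : LSite (F.P K).d → (Matrix (Fin 2) (Fin 2) ℂ)ˣ) (U₁ : LSite (F.P K).d → Fin (F.P K).d → (Matrix (Fin 2) (Fin 2) ℂ)ˣ) (A : LSite (F.P K).d → Fin (F.P K).d → (Matrix (Fin 2) (Fin 2) ℂ)),
      (∀ x, u₁ x ∈ specialUnitaryUnits (Fin 2)) → mgauge (1 : LSite (F.P K).d → Fin (F.P K).d → (Matrix (Fin 2) (Fin 2) ℂ)ˣ) u₁ U₁ = (pull (unitsField (toUField (GaugeField.gaugeAct gJ U))) 0) → Restr129 (F.P K).L m ((cubeLamS (F.P K).L a M' ρ' (K - n)) m) (1 : LSite (F.P K).d → Fin (F.P K).d → (Matrix (Fin 2) (Fin 2) ℂ)ˣ) u₁ → IsLandau138W (F.P K).L m (((F.L : ℝ)⁻¹) ^ (K - n)) ((cubeFam false (F.P K).L a M' ρ' (K - n)) 0) ((cubeLamS (F.P K).L a M' ρ' (K - n)) m) (1 : LSite (F.P K).d → Fin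 (F.P K).d → (Matrix (Fin 2) (Fin 2) ℂ)ˣ) U₁ →
      (∀ j, j ≤ m → ∀ b ∈ {b : LSite (F.P K).d × Fin (F.P K).d | SideTouches ((cubeFam false (F.P K).L a M' ρ' (K - n)) j) b.1 b.2},
        U₁ b.1 b.2 = cfgExp (((F.L : ℝ)⁻¹) ^ (K - n)) A b.1 b.2 ∧ IsSelfAdjoint (A b.1 b.2) ∧ ‖A b.1 b.2‖ ≤ cstar * (((F.P K).L : ℝ) ^ j * (((F.L : ℝ)⁻¹) ^ (K - n)))⁻¹) →
      ∃ (v : LSite (F.P K).d → (Matrix (Fin 2) (Fin 2) ℂ)ˣ) (lam : LSite (F.P K).d → (Matrix (Fin 2) (Fin 2) ℂ)), (∀ x, v x ∈ specialUnitaryUnits (Fin 2)) ∧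
        (∀ j, j ≤ m + 1 → ∀ b ∈ {b : LSite (F.P K).d × Fin (F.P K).d | SideTouches ((cubeFam false (F.P K).L a M' ρ' (K - n)) j) b.1 b.2}, (v b.1 : (Matrix (Fin 2) (Fin 2) ℂ)) = ((gaugeExp lam b.1 : (Matrix (Fin 2) (Fin 2) ℂ)ˣ) : (Matrix (Fin 2) (Fin 2) ℂ)) ∧
          (v (b.1 + e b.2) : (Matrix (Fin 2) (Fin 2) ℂ)) = ((gaugeExp lam (b.1 + e b.2) : (Matrix (Fin 2) (Fin 2) ℂ)ˣ) : (Matrix (Fin 2) (Fin 2) ℂ))) ∧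
        (∀ j, j ≤ m + 1 → ∀ b ∈ {b : LSite (F.P K).d × Fin (F.P K).d | SideTouches ((cubeFam false (F.P K).L a M' ρ' (K - n)) j) b.1 b.2},
          ‖lam b.1‖ ≤ α₄ ∧ (((F.P K).L : ℝ) ^ j * (((F.L : ℝ)⁻¹) ^ (K - n))) * ‖covDerivFwd (((F.L : ℝ)⁻¹) ^ (K - n)) (1 : LSite (F.P K).d → Fin (F.P K).d → (Matrix (Fin 2) (Fin 2) ℂ)ˣ) b.2 lam b.1‖ ≤ α₄) ∧
        IsLandau138W (F.P K).L (m + 1) (((F.L : ℝ)⁻¹) ^ (K - n)) ((cubeFam false (F.P K).L a M' ρ' (K - n)) 0) ((cubeLamS (F.P K).L a M' ρ' (K - n)) (m + 1)) (1 : LSite (F.P K).d → Fin (F.P K).d → (Matrix (Fin 2) (Fin 2) ℂ)ˣ) (mgauge (1 : LSite (F.P K).d → Fin (F.P K).d → (Matrix (Fin 2) (Fin 2) ℂ)ˣ) v⁻¹ U₁) ∧ Restr129 (F.P K).L (m + 1) ((cubeLamS (F.P K).L a M' ρ' (K - n)) (m + 1)) (1 : LSite (F.P K).d → Fin (F.P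 K).d → (Matrix (Fin 2) (Fin 2) ℂ)ˣ) (u₁ * v))
    (H42 : ∀ gJ : GaugeTransf (F.P K) 0 (Matrix.specialUnitaryGroup (Fin 2) ℂ),
      ∀ m, 1 ≤ m → m ≤ K - n → ∀ (u : LSite (F.P K).d → (Matrix (Fin 2) (Fin 2) ℂ)ˣ) (W : LSite (F.P K).d → Fin (F.P K).d → (Matrix (Fin 2) (Fin 2) ℂ)ˣ) (A' : LSite (F.P K).d → Fin (F.P K).d → (Matrix (Fin 2) (Fin 2) ℂ)),
      (∀ x, u x ∈ unitaryUnits (Matrix (Fin 2) (Fin 2) ℂ)) → mgauge (1 : LSite (F.P K).d → Fin (F.P K).d → (Matrix (Fin 2) (Fin 2) ℂ)ˣ) u W = (pull (unitsField (toUField (GaugeField.gaugeAct gJ U))) 0) → Restr129 (F.P K).L m ((cubeLamS (F.P K).L a M' ρ' (K - n)) m) (1 : LSite (F.P K).d → Fin (F.P K).d → (Matrix (Fin 2) (Fin 2) ℂ)ˣ) u → IsLandau138W (F.P K).L m (((F.L : ℝ)⁻¹) ^ (K - n)) ((cubeFam false (F.P K).L a M' ρ' (K - n)) 0) ((cubeLamS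 (F.P K).L a M' ρ' (K - n)) m) (1 : LSite (F.P K).d → Fin (F.P K).d → (Matrix (Fin 2) (Fin 2) ℂ)ˣ) W →
      (∀ y τ, IsSelfAdjoint (A' y τ)) →
      (∀ j, j ≤ m → ∀ y τ, SideTouches ((cubeFam false (F.P K).L a M' ρ' (K - n)) j) y τ →
        W y τ = cfgExp (((F.L : ℝ)⁻¹) ^ (K - n)) A' y τ ∧ ‖A' y τ‖ ≤ (2 * ((F.P K).L * cstar) + 8 * α₄) * (((F.P K).L : ℝ) ^ j * (((F.L : ℝ)⁻¹) ^ (K - n)))⁻¹) →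
      (∀ y τ, (∀ j, j ≤ m → ¬ SideTouches ((cubeFam false (F.P K).L a M' ρ' (K - n)) j) y τ) → A' y τ = 0) →
      ∀ j, j ≤ m → ∀ c ∈ (cubeLamB (F.P K).L a M' ρ' (K - n)) m j, ‖logCovIter (F.P K).L (1 : LSite (F.P K).d → Fin (F.P K).d → (Matrix (Fin 2) (Fin 2) ℂ)ˣ) (iEta (((F.L : ℝ)⁻¹) ^ (K - n)) A') j c.1 c.2‖ < 2 * (F.P K).d * (F.P K).L * α₁)
    (H59 : ∀ gJ : GaugeTransf (F.P K) 0 (Matrix.specialUnitaryGroup (Fin 2) ℂ),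
      ∀ m, 1 ≤ m → m ≤ K - n → ∀ (u : LSite (F.P K).d → (Matrix (Fin 2) (Fin 2) ℂ)ˣ) (W : LSite (F.P K).d → Fin (F.P K).d → (Matrix (Fin 2) (Fin 2) ℂ)ˣ) (A' : LSite (F.P K).d → Fin (F.P K).d → (Matrix (Fin 2) (Fin 2) ℂ)),
      (∀ x, u x ∈ unitaryUnits (Matrix (Fin 2) (Fin 2) ℂ)) → mgauge (1 : LSite (F.P K).d → Fin (F.P K).d → (Matrix (Fin 2) (Fin 2) ℂ)ˣ) u W = (pull (unitsField (toUField (GaugeField.gaugeAct gJ U))) 0) → Restr129 (F.P K).L m ((cubeLamS (F.P K).L a M' ρ' (K - n)) m) (1 : LSite (F.P K).d → Fin (F.P K).d → (Matrix (Fin 2) (Fin 2) ℂ)ˣ) u → IsLandau138W (F.P K).L m (((F.L : ℝ)⁻¹) ^ (K - n)) ((cubeFam false (F.P K).L a M' ρ' (K - n)) 0) ((cubeLamS (F.P K).L a M' ρ' (K - n)) m) (1 : LSite (F.P K).d → Fin (F.P K).d → (Matrix (Fin 2) (Fin 2) ℂ)ˣ) W →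
      (∀ y τ, IsSelfAdjoint (A' y τ)) →
      (∀ j, j ≤ m → ∀ y τ, SideTouches ((cubeFam false (F.P K).L a M' ρ' (K - n)) j) y τ →
        W y τ = cfgExp (((F.L : ℝ)⁻¹) ^ (K - n)) A' y τ ∧ ‖A' y τ‖ ≤ (2 * ((F.P K).L * cstar) + 8 * α₄) * (((F.P K).L : ℝ) ^ j * (((F.L : ℝ)⁻¹) ^ (K - n)))⁻¹) →
      (∀ y τ, (∀ j, j ≤ m → ¬ SideTouches ((cubeFam false (F.P K).L a M' ρ' (K - n)) j) y τ) → A' y τ = 0) →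
      msup (F.P K).L m (((F.L : ℝ)⁻¹) ^ (K - n)) (-(1 : ℝ)) (fun j (b : LSite (F.P K).d × Fin (F.P K).d) => SideTouches ((cubeFam false (F.P K).L a M' ρ' (K - n)) j) b.1 b.2) (fun b => A' b.1 b.2)
          ≤ B₀ * (bondNorm (F.P K).L m (((F.L : ℝ)⁻¹) ^ (K - n)) (-(3 : ℝ)) (cubeFam false (F.P K).L a M' ρ' (K - n)) (fun x μ => Jcur (((F.L : ℝ)⁻¹) ^ (K - n)) (1 : LSite (F.P K).d → Fin (F.P K).d → (Matrix (Fin 2) (Fin 2) ℂ)ˣ) A' μ x)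
            + wsup 1 (fun p : {p : ℕ × (LSite (F.P K).d × Fin (F.P K).d) // p.1 ≤ m ∧ p.2 ∈ (cubeLamB (F.P K).L a M' ρ' (K - n)) m p.1} =>
                linCovIter (F.P K).L (1 : LSite (F.P K).d → Fin (F.P K).d → (Matrix (Fin 2) (Fin 2) ℂ)ˣ) (iEta (((F.L : ℝ)⁻¹) ^ (K - n)) A') p.1.1 p.1.2.1 p.1.2.2)) ∧
        msup (F.P K).L m (((F.L : ℝ)⁻¹) ^ (K - n)) (-(2 : ℝ)) (fun j (t : Fin (F.P K).d × Fin (F.P K).d × LSite (F.P K).d) => SideTouches ((cubeFam false (F.P K).L a M' ρ' (K - n)) j) t.2.2 t.2.1)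
            (fun t => covDerivFwd (((F.L : ℝ)⁻¹) ^ (K - n)) (1 : LSite (F.P K).d → Fin (F.P K).d → (Matrix (Fin 2) (Fin 2) ℂ)ˣ) t.1 (fun z => A' z t.2.1) t.2.2)
          ≤ B₀ * (bondNorm (F.P K).L m (((F.L : ℝ)⁻¹) ^ (K - n)) (-(3 : ℝ)) (cubeFam false (F.P K).L a M' ρ' (K - n)) (fun x μ => Jcur (((F.L : ℝ)⁻¹) ^ (K - n)) (1 : LSite (F.P K).d → Fin (F.P K).d → (Matrix (Fin 2) (Fin 2) ℂ)ˣ) A' μ x)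
            + wsup 1 (fun p : {p : ℕ × (LSite (F.P K).d × Fin (F.P K).d) // p.1 ≤ m ∧ p.2 ∈ (cubeLamB (F.P K).L a M' ρ' (K - n)) m p.1} =>
                linCovIter (F.P K).L (1 : LSite (F.P K).d → Fin (F.P K).d → (Matrix (Fin 2) (Fin 2) ℂ)ˣ) (iEta (((F.L : ℝ)⁻¹) ^ (K - n)) A') p.1.1 p.1.2.1 p.1.2.2))) :
    ∀ gJ : GaugeTransf (F.P K) 0 (Matrix.specialUnitaryGroup (Fin 2) ℂ),
      InAk (F.P K).L (K - n) (((F.L : ℝ)⁻¹) ^ (K - n)) ε₀ (fun _ => (Set.univ : Set (LSite (F.P K).d))) (pull (unitsField (toUField (GaugeField.gaugeAct gJ U))) 0) →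
      (∀ (x : LSite (F.P K).d) (ν : Fin (F.P K).d), tlo (F.P K).L (tLo a ρ') (K - n) ≤ x → x + e ν ≤ thi (F.P K).L (tHi a M' ρ') (K - n) →
        ‖((pull (unitsField (toUField (GaugeField.gaugeAct gJ U))) 0 x ν : (Matrix (Fin 2) (Fin 2) ℂ)ˣ) : Matrix (Fin 2) (Fin 2) ℂ) - 1‖ < s) →
      ∀ m, m ≤ K - n → ∃ u : LSite (F.P K).d → (Matrix (Fin 2) (Fin 2) ℂ)ˣ, (∀ x, ((u x : (Matrix (Fin 2) (Fin 2) ℂ)ˣ) : Matrix (Fin 2) (Fin 2) ℂ) ∈ Matrix.specialUnitaryGroup (Fin 2) ℂ) ∧ Restr129 (F.P K).L m ((cubeLamS (F.P K).L a M' ρ' (K - n)) m) (1 : LSite (F.P K).d → Fin (F.P K).d → (Matrix (Fin 2) (Fin 2) ℂ)ˣ) u ∧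
      ∃ W : LSite (F.P K).d → Fin (F.P K).d → (Matrix (Fin 2) (Fin 2) ℂ)ˣ, mgauge (1 : LSite (F.P K).d → Fin (F.P K).d → (Matrix (Fin 2) (Fin 2) ℂ)ˣ) u W = (pull (unitsField (toUField (GaugeField.gaugeAct gJ U))) 0) ∧ (1 ≤ m → IsLandau138W (F.P K).L m (((F.L : ℝ)⁻¹) ^ (K - n)) ((cubeFam false (F.P K).L a M' ρ' (K - n)) 0) ((cubeLamS (F.P K).L a M' ρ' (K - n)) m) (1 : LSite (F.P K).d → Fin (F.P K).d → (Matrix (Fin 2) (Fin 2) ℂ)ˣ) W) ∧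
        ∃ A : LSite (F.P K).d → Fin (F.P K).d → (Matrix (Fin 2) (Fin 2) ℂ), ∀ j, j ≤ m → ∀ b ∈ {b : LSite (F.P K).d × Fin (F.P K).d | SideTouches ((cubeFam false (F.P K).L a M' ρ' (K - n)) j) b.1 b.2},
          W b.1 b.2 = cfgExp (((F.L : ℝ)⁻¹) ^ (K - n)) A b.1 b.2 ∧ IsSelfAdjoint (A b.1 b.2) ∧ ‖A b.1 b.2‖ ≤ cstar * (((F.P K).L : ℝ) ^ j * (((F.L : ℝ)⁻¹) ^ (K - n)))⁻¹ := by
  subst hadef hρ'def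
  intro gJ hInAk hfine
  have hd2 : 2 ≤ (F.P K).d := by rw [T3Family.P_d F K]; norm_num
  have hL2 : 2 ≤ (F.P K).L := (F.P K).hL.2
  have hη : 0 < ((F.L : ℝ)⁻¹) ^ (K - n) := by
    have hL0 : (0 : ℝ) < F.L := by exact_mod_cast (F.P K).L_pos
    positivity
  have hρL : (F.P K).L ≤ ρ + M + L + S := by
    have hLF : (F.P K).L = F.L := rfl
    rw [hLF, hF]; omega
  have hU' : ∀ (x : LSite (F.P K).d) (κ : Fin (F.P K).d),
      pull (unitsField (toUField (GaugeField.gaugeAct gJ U))) 0 x κ ∈ unitaryUnits (Matrix (Fin 2) (Fin 2) ℂ) :=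
    fun x κ => by rw [pull_apply]; exact unitsField_mem_unitaryUnits _ _
  exact datum_of_preGauge_cubeMember_SU hd2 hη hL2 (K - n) hU' hε₀ hα₁ hα₄ hB₀ hc hs₁ hs₂ hsa4 hs2c hα3 hα4 h16 hd5 hsmall hc₃ hside h50 hC₂ h61
    (fun μ => ((iterBlockOf (K - n) x₀ μ).val : ℤ) - t) M' hρL (cubeLamS (F.P K).L (fun μ => ((iterBlockOf (K - n) x₀ μ).val : ℤ) - t) M' (ρ + M + L + S) (K - n))
    (cubeLamB (F.P K).L (fun μ => ((iterBlockOf (K - n) x₀ μ).val : ℤ) - t) M' (ρ + M + L + S) (K - n))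
    (hbox_cubeLamB (d := (F.P K).d) (F.P K).L _ M' (ρ + M + L + S) (K - n)) hInAk hfine (hP5base gJ) (hP5 gJ) (H42 gJ) (H59 gJ)

end Summit.QuantumFields.YangMills.Theorems.HalvingHSiteDatumOfSockets

end
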